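import Literature.NumberTheory.ComplexMultiplication.CMOrderQuadraticOverorders
import Literature.NumberTheory.ComplexMultiplication.CMOrderPrimeIdealInverse
import HarnessLib

/-!
# Gorenstein orders in any degree: the trace dual `Iᵗ` of a fractional ideal, Lemma 2.3's calculus
# `Iᵗᵗ = I`, `(I:J) = (IᵗJ)ᵗ = (Jᵗ:Iᵗ)`, `(I ∩ J)ᵗ = Iᵗ + Jᵗ`, and Buchmann–Lenstra's Propositions 2.5 / 2.7
# (= Marseglia's Prop. 2.10): `M` Gorenstein ⟺ (`(I:I) = M` iff `I` invertible in `M`) ⟺ `Mᵗ` invertible in `M`,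
# for every over-order `M` of an order `𝔬`; monogenic (in particular quadratic) orders are Gorenstein

Family `hodge`, lane `lit-hodgefound` (Track 2 foundations library; seat p15, row g25-#1 — the general-degree
sequel of g24-#1 `CMOrderQuadraticBass` / g24-#3 `CMOrderQuadraticOverorders` §5, which proved Prop. 2.10 (a), (b)
for QUADRATIC orders through conductors), topic `Literature/NumberTheory/ComplexMultiplication`.  THEOREMS ONLY: no
definition, no instance, no named fact (D-0026, net Literature debt `0`).

Carriers, BY NAME: the order `𝔬 = endOrder (M_μ)` of a lattice `𝔪 = ⊕ ℤμⱼ` (`μ : Basis ι ℚ K`, `K` a number field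
of ANY degree, `ι` any index type — every order is of this form for a `ℤ`-basis `μ` of itself), Mathlib's
`FractionalIdeal 𝔬⁰ K` with `*`, `+`, `⊓`, `spanSingleton` and the ideal quotient `I / J = (I : J)`; the lattice
`L(I) = (↑I : Submodule 𝔬 K).restrictScalars ℤ` of `CMLatticeInvertibleIdeals`; the TRACE DUAL is MATHLIB's
`Submodule.traceDual ℤ ℚ (↑I : Submodule 𝔬 K) = {x ∈ K | ∀ a ∈ I, Tr_{K/ℚ}(xa) ∈ ℤ}` (an `𝔬`-submodule of `K`;
Mathlib's `FractionalIdeal.dual` needs the integral closure and is not available for a non-maximal order), and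
«`T` is the trace dual of `I`» is the hypothesis `(↑T : Submodule 𝔬 K) = traceDual ℤ ℚ ↑I` (§1 proves such a `T`
exists).  As in `CMOrderOverordersIdempotents` / `CMOrderQuadraticBass`, an OVER-ORDER is an idempotent `M = MM ≠ 0`
(LEMMA 2.2), a fractional `M`-ideal is an `I` with `MI = I`, «invertible in `M`» is `IJ = M` / `I·(M:I) = M`, and
every statement about the over-order `M` is made on the base carrier `FractionalIdeal 𝔬⁰ K` (quotients and trace
duals do not depend on the base ring).  §0, §4, §5 hold for every order `𝔯 = endOrder ρ` of the series.

## Sources, VERBATIM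

J. A. Buchmann, H. W. Lenstra, Jr., *Approximating rings of integers in number fields*, J. Théor. Nombres Bordeaux
6 (1994) 221–260 [BuchmannLenstra1994], held `paper:doi-10-5802-jtnb-113`, §2 pp. 228–231 (chunks p0009–p0012):

> (2.3) A fractional `A`-ideal `a` is called invertible if `ab = A` for some fractional `A`-ideal `b`; if this is
> true, then `b = A : a`, and `a = A : b = A : (A : a)`. An example of a fractional ideal is the complementary module
> `A† = {x ∈ A_F : Tr(xA) ⊂ R}`. […] One has `A ⊂ A†` […]. If `a` is a fractional `A`-ideal, then `a : a` is an
> overorder of `A`.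
> **Proposition 2.5.** Let `A` be an order over a principal ideal domain, and let `a` be a fractional `A`-ideal.
> Then `a` is invertible if and only if the overorder `(A : a) : (A : a)` of `A` equals `A`, and if and only if both
> `A : (A : a) = a` and `a : a = A`.  *Proof.* […] Next suppose that `a` is not invertible. Then the `A`-ideal
> `(A : a)a` is different from `A`, so there is a maximal ideal `p` of `A` containing `(A : a)a`. We have
> `A : p ⊂ A : ((A : a)a) = (A : a) : (A : a)`, so from 2.4(b) we see that `(A : a) : (A : a) ≠ A`. […]
> (2.6) We call `A` a Gorenstein ring if `A : (A : a) = a` for every fractional `A`-ideal `a`.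
> **Proposition 2.7.** Let `A` be an order over a principal ideal domain `R`, with complementary module `A†`. Then
> the following properties are equivalent: (a) `A` is a Gorenstein ring; (b) for any fractional `A`-ideal `a`, we
> have `a : a = A` if and only if `a` is invertible; (c) `A†` is invertible.
> *Proof.* From 2.5 and the definition of a Gorenstein ring it is clear that (a) implies (b). To prove that (b)
> implies (c), it suffices to prove that `A† : A† = A`. Generally, put `a† = {x ∈ A_F : Tr(xa) ⊂ R}` […]. Using
> dual bases one easily proves that `a†† = a`, and from the definitions one sees that `a† = A† : a`. Applying this
> to `a = A†` one obtains `A† : A† = A`, as required. Finally, we prove that (c) implies (a). Suppose that `A†` is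
> invertible, and let `a` be a fractional ideal. Applying the equality `a† = A† : a` twice we find that
> `a = a†† = A† : (A† : a)`. […] If `b = A : A†` denotes the inverse of `A†`, then we have
> `A† : a = (A : b) : a = A : (ab) = (A : a) : b = (A : a)A†` and
> `A† : (A† : a) = A† : ((A : a)A†) = (A† : A†) : (A : a) = A : (A : a)`. This proves 2.7.
> (2.8) Example. […] `A = R[X]/fR[X]` […] if we write `α = (X mod f)` then `A† = f′(α)⁻¹A` […]. This shows that
> `A†` is invertible, so 2.7 implies that `A` is a Gorenstein ring.

S. Marseglia, *Computing the ideal class monoid of an order*, J. Lond. Math. Soc. (2) 101 (2020) [Marseglia2019],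
held `paper:arxiv-1805.09671`, §2 pp. 4–5 (chunks p0004–p0005):

> **Lemma 2.1.** Let `I, J, L` be fractional `R`-ideals, then `((I:J):L) = (I:JL)`.
> For every fractional `R`-ideal `I`, we define the trace dual ideal as `I^t = {x ∈ K : Tr(xI) ⊆ ℤ}`. […] Observe
> that `I^t` is a fractional `R`-ideal […].
> **Lemma 2.3.** Let `R` be an order in `K`, let `I` and `J` be two fractional `R`-ideals and let `x` be in `K^×`.
> `(I^t)^t = I`; `I ⊆ J ⟺ J^t ⊆ I^t`; `(I ∩ J)^t = I^t + J^t`; `(xI)^t = (1/x)I^t`; `(I:J) = (I^tJ)^t`;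
> `(I:J) = (J^t:I^t)`; `S = (I:I) ⟺ II^t = S^t`.
> **Proposition 2.10** [Buchmann–Lenstra]. Let `R` be an order with trace dual `R^t`. The following are
> equivalent: (a) for every fractional `R`-ideal `I`, we have `(R:(R:I)) = I`; (b) for every fractional `R`-ideal
> `I`, we have `(I:I) = R` if and only if `I` is invertible; (c) `R^t` is invertible in `R`.  An order satisfying
> one of the equivalent conditions is called Gorenstein.
> **Corollary 2.11.** Monogenic orders are Gorenstein. *Proof.* […] `R = ℤ[α]` and `R^t = (1/f′(α))R`.

## What is formalised

* §0 (ANY order `𝔯 = endOrder ρ`): **LEMMA 2.1** `EndOrder.div_mul_eq_div_div_fractionalIdeal` (`I/(JL) = I/J/L`);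
  `div_ne_zero_of_one_le` (`(S : I) ≠ 0`), `div_div_self_le_div_div_div_self` (`((S:N):(S:N)) ⊆ ((S:(S:N)):(S:(S:N)))`),
  `le_div_div` (`N ⊆ (S:(S:N))`), `one_le_of_mul_self_eq`, `mul_div_eq_div_of_mul_self_eq_left` (`M(M:I) = (M:I)`).
* §1 **«`I^t` is a fractional `R`-ideal»**: `restrictScalars_traceDual_eq` (`L(Iᵗ) = L(I)*`, junction with
  `CMLatticeTraceDual`), **`exists_coe_eq_traceDual`** (a nonzero `T` with `↑T = Iᵗ`), `coe_eq_traceDual_iff`.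
* §2 **LEMMA 2.3**: `traceDual_traceDual_coe` / `eq_of_coe_eq_traceDual_traceDual` (`Iᵗᵗ = I`),
  `traceDual_le_traceDual_iff` / `le_iff_le_of_coe_eq_traceDual` (`I ⊆ J ⟺ Jᵗ ⊆ Iᵗ`), `coe_add_eq_traceDual_inf`
  (`(I ∩ J)ᵗ = Iᵗ + Jᵗ`), `coe_spanSingleton_inv_mul_eq_traceDual` (`(xI)ᵗ = x⁻¹Iᵗ`), `coe_div_eq_traceDual_mul`
  (`(I:J) = (IᵗJ)ᵗ`), `div_eq_div_of_coe_eq_traceDual` (`(I:J) = (Jᵗ:Iᵗ)`), `traceDual_coe_mul_eq_coe_div_self`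
  (`(IIᵗ)ᵗ = (I:I)`) and `div_self_eq_iff_mul_traceDual_eq` (`S = (I:I) ⟺ IIᵗ = Sᵗ`); tool `mem_traceDual_mul_iff`.
* §3 (over-order `M`): `mul_eq_of_coe_eq_traceDual` (`Iᵗ` is an `M`-ideal), `isIntegral_of_mem_of_mul_self_eq`,
  **`le_of_coe_eq_traceDual_self`** («`A ⊂ A†`»), **`traceDual_div_traceDual_eq_of_mul_self_eq`** (`(Mᵗ:Mᵗ) = M`),
  **`traceDual_div_eq_of_mul_eq`** («`a† = A† : a`»).
* §4 **PROP. 2.7 (a)⇒(b)** with no trace duals, for every order `𝔯`: `EndOrder.mul_div_eq_of_forall_div_div_eq`,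
  `EndOrder.div_self_eq_iff_exists_mul_eq_of_forall_div_div_eq`.
* §5 **PROP. 2.5** for the order itself: **`EndOrder.isUnit_iff_one_div_div_one_div_eq_one`** (`a` invertible ⟺
  `((A:a):(A:a)) = A`, through the tree's Prop. 2.4 (b) `NumberRing.not_inv_coeIdeal_le_one`),
  **`EndOrder.isUnit_iff_one_div_one_div_eq_and_div_self_eq_one`**.
* §6 **PROP. 2.7 (b)⇒(c)** `traceDual_mul_div_eq_of_forall_mul_div_eq`, **(c)⇒(a)** `div_div_eq_of_traceDual_mul_eq`
  (Buchmann–Lenstra's computation verbatim), the equivalences **`forall_div_div_eq_iff_traceDual_mul_div_eq`**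
  ((a)⟺(c)) and **`forall_div_div_eq_iff_forall_div_self_eq_iff_mul_div_eq`** ((a)⟺(b)) for every over-order `M`,
  and for the order itself **`forall_one_div_one_div_eq_iff_isUnit_traceDual`**,
  **`forall_one_div_one_div_eq_iff_forall_isUnit_iff_div_self_eq_one`**.
* §7 **EXAMPLE 2.8 / COR. 2.11**: `eq_spanSingleton_inv_mul_of_monogenic` (`ℤ[π]ᵗ = f′(π)⁻¹ℤ[π]`, via
  `CMLatticeTraceDual.traceDual_adjoin_eq`), `traceDual_mul_eq_of_monogenic`, **`div_div_eq_of_monogenic`** (monogenic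
  over-orders are Gorenstein), `one_div_one_div_eq_and_isUnit_iff_of_monogenic` (the monogenic order itself);
  VALIDATION at `g = 1`: **`exists_traceDual_one_eq_spanSingleton_inv`** — the trace dual of every quadratic order is
  principal (`= γ⁻¹𝔬`) and invertible, re-deriving `CMOrderQuadraticOverorders.one_div_one_div_eq` by the printed
  route.

NOT formalised: Prop. 2.4 (a), (c) and the index identity `(A† : A) = Δ_A`; the «traditional notion» of Gorenstein
(Bass 1963) and its equivalence; Prop. 2.5 relative to an over-order (it needs Prop. 2.4 (b) for the over-order as a
ring); Bass orders / Prop. 3.7 in general degree (next row).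

## References
* [BuchmannLenstra1994] J. A. Buchmann, H. W. Lenstra, Jr., *Approximating rings of integers in number fields*,
  J. Théor. Nombres Bordeaux 6 (1994) 221–260, §2.3, Prop. 2.5, §2.6, Prop. 2.7, Example 2.8, pp. 228–231.
  [cite: BuchmannLenstra1994, §2 Prop. 2.7, p. 230]
* [Marseglia2019] S. Marseglia, *Computing the ideal class monoid of an order*, J. Lond. Math. Soc. (2) 101 (2020)
  984–1007, §2 Lemma 2.1, Lemma 2.3, Prop. 2.10, Cor. 2.11, pp. 4–5. [cite: Marseglia2019, §2 Prop. 2.10, p. 5]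
* [Shimura1973] G. Shimura, *Introduction to the Arithmetic Theory of Automorphic Functions* (1971), §4.4 proof of
  Prop. 4.11, pp. 105–106 (`𝔞𝔞* = 𝔬*`, `𝔬* = g′(π)⁻¹𝔬`). [cite: Shimura1973, §4.4 Prop. 4.11 (proof), pp. 105–106]
* [Stevenhagen2008NumberRings] P. Stevenhagen, *The arithmetic of number rings*, MSRI Publ. 44 (2008), §6 Lemma 6.4
  (integrality), §9 (`𝔭⁻¹ ⊋ R`). [cite: Stevenhagen2008NumberRings, §6 Lemma 6.4, p. 222]
-/

noncomputable section

open scoped nonZeroDivisors NumberField Pointwise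
open NumberField Module FractionalIdeal
open Submodule (traceDual)

namespace Literature.NumberTheory.ComplexMultiplication

/-! ## §0 Bookkeeping for every order `𝔯 = endOrder ρ`: LEMMA 2.1 `(I : JL) = ((I:J):L)`, modules over an
over-order `M = MM`, denominators -/

namespace EndOrder

section AnyOrder

variable {K : Type} [Field K] [NumberField K]
variable {ι : Type} [Fintype ι] [DecidableEq ι] {ρ : K →ₐ[ℚ] Matrix ι ι ℚ}
variable [IsFractionRing (endOrder ρ) K]

/-- **LEMMA 2.1: `((I:J):L) = (I:JL)`** for fractional ideals of an order (`J, L ≠ 0`), on Mathlib's ideal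
quotient `I / J = (I : J)`: «`x ∈ ((I:J):L)`, then `xL ⊆ (I:J)` and so `xJL ⊆ I`». [cite: Marseglia2019, §2 Lemma 2.1, p. 4]
[cite: BuchmannLenstra1994, §2 Prop. 2.7 (proof: «`(A:b):a = A:(ab)`»), p. 230] -/
theorem div_mul_eq_div_div_fractionalIdeal {I J L : FractionalIdeal (endOrder ρ)⁰ K} (hJ : J ≠ 0) (hL : L ≠ 0) :
    I / (J * L) = I / J / L := by
  ext x
  rw [← spanSingleton_le_iff_mem, ← spanSingleton_le_iff_mem, le_div_iff_mul_le (fractionalIdeal_mul_ne_zero hJ hL),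
    le_div_iff_mul_le hL, le_div_iff_mul_le hJ, mul_assoc, mul_comm L J]

/-- A common denominator: for every fractional ideal `I` there is `0 ≠ a ∈ 𝔯` with `a ∈ (S : I)` as soon as
`𝔯 ⊆ S` — in particular **`(S : I) ≠ 0`** («there exists a non-zero divisor `x ∈ K` such that `xI` is an ideal
of `R`»). [cite: Marseglia2019, §2 (before Lemma 2.1), p. 4] -/
theorem div_ne_zero_of_one_le {S I : FractionalIdeal (endOrder ρ)⁰ K} (h1 : 1 ≤ S) (hI : I ≠ 0) : S / I ≠ 0 := by
  obtain ⟨a, ha, haI⟩ := I.isFractional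
  have ha0 : ((a : endOrder ρ) : K) ≠ 0 := fun h => nonZeroDivisors.ne_zero ha (Subtype.ext h)
  intro h0
  have haS : ((a : endOrder ρ) : K) ∈ S / I := by
    rw [mem_div_iff_of_ne_zero hI]
    intro y hy
    obtain ⟨z, hz⟩ := haI y hy
    refine h1 ((mem_one_iff _).2 ⟨z, ?_⟩)
    simp only [Algebra.smul_def, Algebra.algebraMap_ofSubsemiring_apply] at hz ⊢
    exact hz
  rw [h0] at haS
  exact ha0 ((mem_zero_iff _).1 haS)

/-- `x·(S : N) ⊆ (S : N)` forces `x·(S : (S : N)) ⊆ (S : (S : N))` («by definition of quotient ideal»): the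
multiplicator ring of a quotient `(S : N)` is contained in that of the double quotient.
[cite: BuchmannLenstra1994, §2 Prop. 2.5 (proof), p. 230] [cite: Marseglia2019, §2 (the ideal quotient), p. 4] -/
theorem div_div_self_le_div_div_div_self {S N : FractionalIdeal (endOrder ρ)⁰ K} (hSN : S / N ≠ 0)
    (hSSN : S / (S / N) ≠ 0) : S / N / (S / N) ≤ S / (S / N) / (S / (S / N)) := by
  intro x hx
  rw [mem_div_iff_of_ne_zero hSN] at hx
  rw [mem_div_iff_of_ne_zero hSSN]
  intro y hy
  rw [mem_div_iff_of_ne_zero hSN] at hy ⊢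
  intro z hz
  rw [mul_assoc, mul_left_comm]
  exact hy _ (hx z hz)

/-- `N ⊆ (S : (S : N))` for every `N` («`I ⊆ (R:(R:I))`», the easy inclusion of reflexivity).
[cite: BuchmannLenstra1994, §2.6 (definition of a Gorenstein ring), p. 230] -/
theorem le_div_div {S N : FractionalIdeal (endOrder ρ)⁰ K} (hSN : S / N ≠ 0) : N ≤ S / (S / N) := by
  intro x hx
  rw [mem_div_iff_of_ne_zero hSN]
  intro y hy
  have hN0 : N ≠ 0 := by rintro rfl; exact hSN (by simp)
  rw [mul_comm]
  exact (mem_div_iff_of_ne_zero hN0).1 hy x hx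

variable [Nonempty ι]

/-- An over-order `M = MM ≠ 0` contains the order: `1 ≤ M` (it contains `1` by the determinant trick,
LEMMA 2.2). [cite: Marseglia2019, §2 Lemma 2.2, p. 4] -/
theorem one_le_of_mul_self_eq {M : FractionalIdeal (endOrder ρ)⁰ K} (hMM : M * M = M) (hM0 : M ≠ 0) : 1 ≤ M := by
  haveI := CMTypeLattice.isNoetherianRing_endOrder ρ
  rw [FractionalIdeal.one_le]
  exact one_mem_of_mul_self_eq hM0 hMM

/-- **`M·(M : I) = (M : I)`**: a quotient `(M : I)` against the over-order `M = MM` is an `M`-module (the relative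
dual `(S : I)` of a fractional ideal is a fractional `S`-ideal). [cite: Marseglia2019, §2 («the ideal quotient … are
fractional `R`-ideals», for the order `S`), p. 4] -/
theorem mul_div_eq_div_of_mul_self_eq_left {M I : FractionalIdeal (endOrder ρ)⁰ K} (hMM : M * M = M) (hM0 : M ≠ 0)
    (hI : I ≠ 0) : M * (M / I) = M / I := by
  haveI := CMTypeLattice.isNoetherianRing_endOrder ρ
  refine le_antisymm (mul_le.2 fun m hm y hy => ?_) fun x hx => ?_
  · rw [mem_div_iff_of_ne_zero hI] at hy ⊢
    intro z hz
    rw [mul_assoc]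
    exact hMM.le (mul_mem_mul hm (hy z hz))
  · rw [← one_mul x]
    exact mul_mem_mul (one_mem_of_mul_self_eq hM0 hMM) hx

end AnyOrder

end EndOrder

/-! ## §1 The trace dual `Iᵗ = {x ∈ K : Tr(xI) ⊆ ℤ}` of a fractional ideal of the order `𝔬 = endOrder (M_μ)` IS a
fractional ideal (Mathlib's `Submodule.traceDual ℤ ℚ ↑I`, an `𝔬`-submodule of `K`) -/

namespace CMTypeLattice

section TraceDualIdeal

variable {K : Type} [Field K] [NumberField K]
variable {ι : Type} [Fintype ι] [DecidableEq ι] (μ : Basis ι ℚ K)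

/-- The trace dual of an `𝔬`-submodule, read as a `ℤ`-submodule, is the lattice trace dual of its lattice
(`L(Iᵗ) = L(I)*` in the vocabulary of `CMLatticeTraceDual`). [cite: Marseglia2019, §2 («`I^t = {x ∈ K : Tr(xI) ⊆ ℤ}`»), p. 4] -/
theorem restrictScalars_traceDual_eq (I : Submodule (endOrder (Algebra.leftMulMatrix μ)) K) :
    (traceDual ℤ ℚ I).restrictScalars ℤ = traceDual ℤ ℚ (I.restrictScalars ℤ) := by
  ext x
  simp only [Submodule.restrictScalars_mem, Submodule.mem_traceDual, iff_self]

/-- **«Observe that `I^t` is a fractional `R`-ideal»**: for every nonzero fractional ideal `I` of the order `𝔬`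
there is a (nonzero) fractional ideal `T` with `↑T = Iᵗ` — the lattice `L(I) = ⊕ ℤνⱼ` has dual `⊕ ℤνⱼᵛ`
(«`I^t = x₁*ℤ ⊕ … ⊕ xₙ*ℤ` where `{xⱼ*}` is the trace dual basis»), which is `𝔬`-stable because `L(I)` is.
[cite: Marseglia2019, §2 (trace dual ideal), p. 4] [cite: BuchmannLenstra1994, §2.3 («the complementary module `A†`»), p. 228] -/
theorem exists_coe_eq_traceDual {I : FractionalIdeal (endOrder (Algebra.leftMulMatrix μ))⁰ K} (hI : I ≠ 0) :
    ∃ T : FractionalIdeal (endOrder (Algebra.leftMulMatrix μ))⁰ K, T ≠ 0 ∧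
      (T : Submodule (endOrder (Algebra.leftMulMatrix μ)) K) =
        traceDual ℤ ℚ (I : Submodule (endOrder (Algebra.leftMulMatrix μ)) K) := by
  obtain ⟨ν, hν⟩ := exists_basis_span_eq_restrictScalars_coe μ hI
  -- the dual lattice `⊕ ℤνⱼᵛ = L(I)*` is `𝔬`-stable
  have hstab : endOrder (Algebra.leftMulMatrix μ) ≤ endOrder (Algebra.leftMulMatrix ν.traceDual) := by
    intro α hα
    rw [mem_endOrder_leftMulMatrix_iff_forall]
    intro x hx
    rw [← traceDual_span_eq ν, hν] at hx ⊢
    have hO := mul_traceDual_le (div_self_mul_restrictScalars_le μ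
      (I : Submodule (endOrder (Algebra.leftMulMatrix μ)) K))
    exact hO (Submodule.mul_mem_mul ((mem_endOrder_iff_mem_div_self μ).1 hα) hx)
  obtain ⟨T, hT0, hT⟩ := exists_fractionalIdeal_coe_eq (Algebra.leftMulMatrix μ) ν.traceDual hstab
  refine ⟨T, hT0, SetLike.coe_injective ?_⟩
  change (T : Set K) = _
  rw [hT, ← traceDual_span_eq ν, hν, ← restrictScalars_traceDual_eq, Submodule.coe_restrictScalars]

/-- The lattice of the trace dual: `↑T = Iᵗ` iff `L(T) = L(I)*`. [cite: Marseglia2019, §2 (trace dual ideal), p. 4] -/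
theorem coe_eq_traceDual_iff {I T : FractionalIdeal (endOrder (Algebra.leftMulMatrix μ))⁰ K} :
    (T : Submodule (endOrder (Algebra.leftMulMatrix μ)) K) =
        traceDual ℤ ℚ (I : Submodule (endOrder (Algebra.leftMulMatrix μ)) K) ↔
      (T : Submodule (endOrder (Algebra.leftMulMatrix μ)) K).restrictScalars ℤ =
        traceDual ℤ ℚ ((I : Submodule (endOrder (Algebra.leftMulMatrix μ)) K).restrictScalars ℤ) := by
  rw [← restrictScalars_traceDual_eq, (Submodule.restrictScalars_injective ℤ _ K).eq_iff]

/-! ## §2 LEMMA 2.3 — the trace-dual calculus: `Iᵗᵗ = I`, `I ⊆ J ⟺ Jᵗ ⊆ Iᵗ`, `(xI)ᵗ = x⁻¹Iᵗ`, `(I:J) = (IᵗJ)ᵗ = (Jᵗ:Iᵗ)`,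
`(I ∩ J)ᵗ = Iᵗ + Jᵗ`, `(IIᵗ)ᵗ = (I:I)` -/

/-- **`(I^t)^t = I`.** [cite: Marseglia2019, §2 Lemma 2.3, p. 4] [cite: BuchmannLenstra1994, §2 Prop. 2.7 (proof: «using
dual bases one easily proves that `a†† = a`»), p. 230] -/
theorem traceDual_traceDual_coe {I : FractionalIdeal (endOrder (Algebra.leftMulMatrix μ))⁰ K} (hI : I ≠ 0) :
    traceDual ℤ ℚ (traceDual ℤ ℚ (I : Submodule (endOrder (Algebra.leftMulMatrix μ)) K)) = I := by
  obtain ⟨ν, hν⟩ := exists_basis_span_eq_restrictScalars_coe μ hI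
  apply Submodule.restrictScalars_injective ℤ
  rw [restrictScalars_traceDual_eq, restrictScalars_traceDual_eq, ← hν, traceDual_traceDual_span]

/-- `Iᵗᵗ = I` on fractional ideals: if `↑T = Iᵗ` and `↑T′ = Tᵗ` then `T′ = I`. [cite: Marseglia2019, §2 Lemma 2.3, p. 4] -/
theorem eq_of_coe_eq_traceDual_traceDual {I T T' : FractionalIdeal (endOrder (Algebra.leftMulMatrix μ))⁰ K} (hI : I ≠ 0)
    (hT : (T : Submodule (endOrder (Algebra.leftMulMatrix μ)) K) =
      traceDual ℤ ℚ (I : Submodule (endOrder (Algebra.leftMulMatrix μ)) K))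
    (hT' : (T' : Submodule (endOrder (Algebra.leftMulMatrix μ)) K) =
      traceDual ℤ ℚ (T : Submodule (endOrder (Algebra.leftMulMatrix μ)) K)) : T' = I :=
  coeToSubmodule_inj.1 (by rw [hT', hT, traceDual_traceDual_coe μ hI])

/-- `J ⊆ I ⟹ Iᵗ ⊆ Jᵗ` (for all `𝔬`-submodules). [cite: Marseglia2019, §2 Lemma 2.3, p. 4] -/
theorem traceDual_anti_coe {I J : Submodule (endOrder (Algebra.leftMulMatrix μ)) K} (h : J ≤ I) :
    traceDual ℤ ℚ I ≤ traceDual ℤ ℚ J := fun x hx => by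
  rw [Submodule.mem_traceDual] at hx ⊢
  exact fun a ha => hx a (h ha)

/-- **`I ⊆ J ⟺ J^t ⊆ I^t`.** [cite: Marseglia2019, §2 Lemma 2.3, p. 4] -/
theorem traceDual_le_traceDual_iff {I J : FractionalIdeal (endOrder (Algebra.leftMulMatrix μ))⁰ K} (hI : I ≠ 0)
    (hJ : J ≠ 0) :
    traceDual ℤ ℚ (J : Submodule (endOrder (Algebra.leftMulMatrix μ)) K) ≤
        traceDual ℤ ℚ (I : Submodule (endOrder (Algebra.leftMulMatrix μ)) K) ↔ I ≤ J := by
  refine ⟨fun h => ?_, fun h => traceDual_anti_coe μ (coe_le_coe.2 h)⟩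
  have h2 := traceDual_anti_coe μ h
  rwa [traceDual_traceDual_coe μ hI, traceDual_traceDual_coe μ hJ, coe_le_coe] at h2

/-- The same with named duals: `↑TI = Iᵗ`, `↑TJ = Jᵗ` ⟹ (`I ⊆ J ⟺ TJ ⊆ TI`). [cite: Marseglia2019, §2 Lemma 2.3, p. 4] -/
theorem le_iff_le_of_coe_eq_traceDual {I J TI TJ : FractionalIdeal (endOrder (Algebra.leftMulMatrix μ))⁰ K}
    (hI : I ≠ 0) (hJ : J ≠ 0)
    (hTI : (TI : Submodule (endOrder (Algebra.leftMulMatrix μ)) K) =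
      traceDual ℤ ℚ (I : Submodule (endOrder (Algebra.leftMulMatrix μ)) K))
    (hTJ : (TJ : Submodule (endOrder (Algebra.leftMulMatrix μ)) K) =
      traceDual ℤ ℚ (J : Submodule (endOrder (Algebra.leftMulMatrix μ)) K)) : I ≤ J ↔ TJ ≤ TI := by
  rw [← coe_le_coe (I := TJ), hTI, hTJ, traceDual_le_traceDual_iff μ hI hJ]

/-- `(𝔬y)·N ⊆ P ⟺ yN ⊆ P` (bookkeeping for cyclic submodules; the ideal quotient elementwise). [cite: Marseglia2019, §2 («`(I:J) = {x ∈ K : xJ ⊆ I}`»), p. 4] -/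
private theorem span_singleton_mul_le_iff {y : K} {N P : Submodule (endOrder (Algebra.leftMulMatrix μ)) K} :
    Submodule.span (endOrder (Algebra.leftMulMatrix μ)) {y} * N ≤ P ↔ ∀ n ∈ N, y * n ∈ P := by
  refine ⟨fun h n hn => h (Submodule.mul_mem_mul (Submodule.mem_span_singleton_self y) hn), fun h => ?_⟩
  rw [Submodule.mul_le]
  intro m hm n hn
  obtain ⟨r, rfl⟩ := Submodule.mem_span_singleton.1 hm
  rw [smul_mul_assoc]
  exact P.smul_mem r (h n hn)

/-- `y ∈ (N·N′)ᵗ ⟺ yN′ ⊆ Nᵗ` («`Tr(y·nn′) = Tr((yn′)·n)`»; Mathlib's `le_traceDual_mul_iff` on the cyclic module `𝔬y`).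
[cite: Marseglia2019, §2 Lemma 2.3 (proof mechanism), p. 4] -/
theorem mem_traceDual_mul_iff {y : K} {N N' : Submodule (endOrder (Algebra.leftMulMatrix μ)) K} :
    y ∈ traceDual ℤ ℚ (N * N') ↔ ∀ n ∈ N', y * n ∈ traceDual ℤ ℚ N := by
  rw [← Submodule.span_singleton_le_iff_mem, mul_comm, Submodule.le_traceDual_mul_iff, span_singleton_mul_le_iff]

/-- **`(I ∩ J)^t = I^t + J^t`** (`↑TI = Iᵗ`, `↑TJ = Jᵗ`): `⊇` by antitonicity; `⊆` by dualising
`(TI + TJ)ᵗ ⊆ TIᵗ ∩ TJᵗ = I ∩ J`. [cite: Marseglia2019, §2 Lemma 2.3, p. 4] -/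
theorem coe_add_eq_traceDual_inf {I J TI TJ : FractionalIdeal (endOrder (Algebra.leftMulMatrix μ))⁰ K}
    (hI : I ≠ 0) (hJ : J ≠ 0) (hTI0 : TI ≠ 0)
    (hTI : (TI : Submodule (endOrder (Algebra.leftMulMatrix μ)) K) =
      traceDual ℤ ℚ (I : Submodule (endOrder (Algebra.leftMulMatrix μ)) K))
    (hTJ : (TJ : Submodule (endOrder (Algebra.leftMulMatrix μ)) K) =
      traceDual ℤ ℚ (J : Submodule (endOrder (Algebra.leftMulMatrix μ)) K)) :
    ((TI + TJ : FractionalIdeal (endOrder (Algebra.leftMulMatrix μ))⁰ K) : Submodule (endOrder (Algebra.leftMulMatrix μ)) K) =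
      traceDual ℤ ℚ ((I ⊓ J : FractionalIdeal (endOrder (Algebra.leftMulMatrix μ))⁰ K) :
        Submodule (endOrder (Algebra.leftMulMatrix μ)) K) := by
  have hU0 : TI + TJ ≠ 0 := fun h => hTI0 (le_antisymm (by rw [← h]; exact le_sup_left) (zero_le _))
  refine le_antisymm ?_ ?_
  · rw [coe_add, coe_inf]
    exact sup_le (hTI.le.trans (traceDual_anti_coe μ inf_le_left)) (hTJ.le.trans (traceDual_anti_coe μ inf_le_right))
  · -- `(TI + TJ)ᵗ ⊆ TIᵗ ∩ TJᵗ = I ∩ J`, hence `(I ∩ J)ᵗ ⊆ (TI + TJ)ᵗᵗ = TI + TJ`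
    obtain ⟨V, -, hV⟩ := exists_coe_eq_traceDual μ hU0
    have hVle : V ≤ I ⊓ J := by
      refine le_inf ?_ ?_
      · rw [← coe_le_coe, hV, ← traceDual_traceDual_coe μ hI, ← hTI]
        exact traceDual_anti_coe μ (by rw [coe_add]; exact le_sup_left)
      · rw [← coe_le_coe, hV, ← traceDual_traceDual_coe μ hJ, ← hTJ]
        exact traceDual_anti_coe μ (by rw [coe_add]; exact le_sup_right)
    have h2 := traceDual_anti_coe μ (coe_le_coe.2 hVle)
    rwa [hV, traceDual_traceDual_coe μ hU0] at h2

section Quotients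

variable [IsFractionRing (endOrder (Algebra.leftMulMatrix μ)) K]

/-- **`(xI)^t = x⁻¹ I^t`** (`x ∈ K^×`): if `↑T = Iᵗ` then `↑(x⁻¹T) = (xI)ᵗ`. [cite: Marseglia2019, §2 Lemma 2.3, p. 4] -/
theorem coe_spanSingleton_inv_mul_eq_traceDual {I T : FractionalIdeal (endOrder (Algebra.leftMulMatrix μ))⁰ K} {x : K}
    (hx : x ≠ 0)
    (hT : (T : Submodule (endOrder (Algebra.leftMulMatrix μ)) K) =
      traceDual ℤ ℚ (I : Submodule (endOrder (Algebra.leftMulMatrix μ)) K)) :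
    ((spanSingleton (endOrder (Algebra.leftMulMatrix μ))⁰ x⁻¹ * T :
        FractionalIdeal (endOrder (Algebra.leftMulMatrix μ))⁰ K) : Submodule (endOrder (Algebra.leftMulMatrix μ)) K) =
      traceDual ℤ ℚ ((spanSingleton (endOrder (Algebra.leftMulMatrix μ))⁰ x * I :
        FractionalIdeal (endOrder (Algebra.leftMulMatrix μ))⁰ K) : Submodule (endOrder (Algebra.leftMulMatrix μ)) K) := by
  ext y
  rw [mem_coe, coe_mul, coe_spanSingleton, mul_comm (Submodule.span _ _) _, mem_traceDual_mul_iff, ← hT]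
  constructor
  · intro hy n hn
    obtain ⟨t, ht, rfl⟩ := mem_singleton_mul.1 hy
    obtain ⟨r, rfl⟩ := Submodule.mem_span_singleton.1 hn
    rw [Algebra.smul_def, Algebra.algebraMap_ofSubsemiring_apply,
      show x⁻¹ * t * ((r : K) * x) = x⁻¹ * x * ((r : K) * t) by ring, inv_mul_cancel₀ hx, one_mul]
    have h := (T : Submodule (endOrder (Algebra.leftMulMatrix μ)) K).smul_mem r (mem_coe.2 ht)
    rwa [Algebra.smul_def, Algebra.algebraMap_ofSubsemiring_apply] at h
  · intro hy
    have hyx := hy x (Submodule.mem_span_singleton_self x)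
    rw [mem_coe] at hyx
    exact mem_singleton_mul.2 ⟨y * x, hyx, by rw [mul_comm y x, ← mul_assoc, inv_mul_cancel₀ hx, one_mul]⟩

/-- **`(I:J) = (I^t J)^t`**: if `↑T = Iᵗ` then `↑(I / J) = (TJ)ᵗ` («`x ∈ (IᵗJ)ᵗ ⟺ xJ ⊆ Iᵗᵗ = I`»).
[cite: Marseglia2019, §2 Lemma 2.3, p. 4] [cite: BuchmannLenstra1994, §2 Prop. 2.7 (proof: «`a† = A† : a`»), p. 230] -/
theorem coe_div_eq_traceDual_mul {I J T : FractionalIdeal (endOrder (Algebra.leftMulMatrix μ))⁰ K} (hI : I ≠ 0)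
    (hJ : J ≠ 0)
    (hT : (T : Submodule (endOrder (Algebra.leftMulMatrix μ)) K) =
      traceDual ℤ ℚ (I : Submodule (endOrder (Algebra.leftMulMatrix μ)) K)) :
    ((I / J : FractionalIdeal (endOrder (Algebra.leftMulMatrix μ))⁰ K) : Submodule (endOrder (Algebra.leftMulMatrix μ)) K) =
      traceDual ℤ ℚ ((T * J : FractionalIdeal (endOrder (Algebra.leftMulMatrix μ))⁰ K) :
        Submodule (endOrder (Algebra.leftMulMatrix μ)) K) := by
  ext y
  rw [mem_coe, mem_div_iff_of_ne_zero hJ, coe_mul, mem_traceDual_mul_iff, hT, traceDual_traceDual_coe μ hI]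
  simp only [mem_coe]

/-- **`(I:J) = (J^t : I^t)`**: if `↑TI = Iᵗ` and `↑TJ = Jᵗ` then `I / J = TJ / TI`.
[cite: Marseglia2019, §2 Lemma 2.3, p. 4] -/
theorem div_eq_div_of_coe_eq_traceDual {I J TI TJ : FractionalIdeal (endOrder (Algebra.leftMulMatrix μ))⁰ K}
    (hI : I ≠ 0) (hJ : J ≠ 0) (hTI0 : TI ≠ 0)
    (hTI : (TI : Submodule (endOrder (Algebra.leftMulMatrix μ)) K) =
      traceDual ℤ ℚ (I : Submodule (endOrder (Algebra.leftMulMatrix μ)) K))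
    (hTJ : (TJ : Submodule (endOrder (Algebra.leftMulMatrix μ)) K) =
      traceDual ℤ ℚ (J : Submodule (endOrder (Algebra.leftMulMatrix μ)) K)) : I / J = TJ / TI := by
  apply coeToSubmodule_inj.1
  rw [coe_div_eq_traceDual_mul μ hI hJ hTI]
  ext y
  rw [coe_mul, mul_comm, mem_traceDual_mul_iff, ← hTJ, mem_coe, mem_div_iff_of_ne_zero hTI0]
  simp only [mem_coe]

/-- **`(I I^t)^t = (I : I)`** — the multiplicator ring is the dual of `IIᵗ` (the instance `J = I` of `(I:J) = (IᵗJ)ᵗ`;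
dualising gives LEMMA 2.3's last bullet «`S = (I:I) ⟺ IIᵗ = Sᵗ`», below).
[cite: Marseglia2019, §2 Lemma 2.3, p. 4] [cite: Shimura1973, §4.4 Prop. 4.11 (proof: «𝔞𝔞* = 𝔬*»), p. 106] -/
theorem traceDual_coe_mul_eq_coe_div_self {I T : FractionalIdeal (endOrder (Algebra.leftMulMatrix μ))⁰ K} (hI : I ≠ 0)
    (hT : (T : Submodule (endOrder (Algebra.leftMulMatrix μ)) K) =
      traceDual ℤ ℚ (I : Submodule (endOrder (Algebra.leftMulMatrix μ)) K)) :
    traceDual ℤ ℚ ((I * T : FractionalIdeal (endOrder (Algebra.leftMulMatrix μ))⁰ K) :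
        Submodule (endOrder (Algebra.leftMulMatrix μ)) K) =
      ((I / I : FractionalIdeal (endOrder (Algebra.leftMulMatrix μ))⁰ K) : Submodule (endOrder (Algebra.leftMulMatrix μ)) K) := by
  rw [coe_div_eq_traceDual_mul μ hI hI hT, mul_comm]

/-- **LEMMA 2.3, last bullet: `S = (I:I) ⟺ I I^t = S^t`** for an over-order `S = M` (`MM = M ≠ 0`, with `↑TM = Mᵗ`,
`↑T = Iᵗ`). [cite: Marseglia2019, §2 Lemma 2.3, p. 4] [cite: Shimura1973, §4.4 p. 106 («𝔞𝔞* = 𝔬* holds for any proper 𝔬-ideal 𝔞 with any order 𝔬»), p. 106] -/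
theorem div_self_eq_iff_mul_traceDual_eq {I T M TM : FractionalIdeal (endOrder (Algebra.leftMulMatrix μ))⁰ K}
    (hI : I ≠ 0) (hT0 : T ≠ 0) (hM0 : M ≠ 0)
    (hT : (T : Submodule (endOrder (Algebra.leftMulMatrix μ)) K) =
      traceDual ℤ ℚ (I : Submodule (endOrder (Algebra.leftMulMatrix μ)) K))
    (hTM : (TM : Submodule (endOrder (Algebra.leftMulMatrix μ)) K) =
      traceDual ℤ ℚ (M : Submodule (endOrder (Algebra.leftMulMatrix μ)) K)) : I / I = M ↔ I * T = TM := by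
  have hIT0 : I * T ≠ 0 := EndOrder.fractionalIdeal_mul_ne_zero hI hT0
  constructor
  · intro h
    apply coeToSubmodule_inj.1
    rw [hTM, ← h, ← traceDual_coe_mul_eq_coe_div_self μ hI hT, traceDual_traceDual_coe μ hIT0]
  · intro h
    apply coeToSubmodule_inj.1
    rw [← traceDual_coe_mul_eq_coe_div_self μ hI hT, h, hTM, traceDual_traceDual_coe μ hM0]

end Quotients

/-! ## §3 The trace dual of an over-order `M = MM`: `M ⊆ Mᵗ` (traces of integral elements), `M·Iᵗ = Iᵗ` for every
`M`-ideal `I`, `(Mᵗ : Mᵗ) = M`, and `Iᵗ = (Mᵗ : I)` -/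

section OverOrder

variable [IsFractionRing (endOrder (Algebra.leftMulMatrix μ)) K]

omit [IsFractionRing (endOrder (Algebra.leftMulMatrix μ)) K] in
/-- **`Iᵗ` is an `S`-ideal when `I` is**: `MI = I` and `1 ∈ M` give `M·T = T` for `↑T = Iᵗ` («`I^t` is a fractional
`R`-ideal», for the order `S = M`; `Tr(mt·a) = Tr(t·ma)`). [cite: Marseglia2019, §2 (trace dual ideal), p. 4]
[cite: Shimura1973, §4.4 Prop. 4.11 (proof: «if 𝔬𝔞 ⊂ 𝔞, we have 𝔬𝔞* ⊂ 𝔞*»), p. 106] -/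
theorem mul_eq_of_coe_eq_traceDual {M I T : FractionalIdeal (endOrder (Algebra.leftMulMatrix μ))⁰ K} (hMI : M * I = I)
    (h1 : (1 : K) ∈ M)
    (hT : (T : Submodule (endOrder (Algebra.leftMulMatrix μ)) K) =
      traceDual ℤ ℚ (I : Submodule (endOrder (Algebra.leftMulMatrix μ)) K)) : M * T = T := by
  refine le_antisymm (mul_le.2 fun m hm t ht => ?_) fun t ht => ?_
  · have ht' : t ∈ traceDual ℤ ℚ (I : Submodule (endOrder (Algebra.leftMulMatrix μ)) K) := by
      rw [← hT]; exact mem_coe.2 ht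
    rw [← mem_coe, hT, Submodule.mem_traceDual]
    rw [Submodule.mem_traceDual] at ht'
    intro a ha
    have hma : m * a ∈ (I : Submodule (endOrder (Algebra.leftMulMatrix μ)) K) :=
      mem_coe.2 (hMI.le (mul_mem_mul hm (mem_coe.1 ha)))
    have h := ht' (m * a) hma
    rw [Algebra.traceForm_apply] at h ⊢
    rwa [mul_assoc, mul_left_comm]
  · rw [← one_mul t]
    exact mul_mem_mul h1 ht

omit [IsFractionRing (endOrder (Algebra.leftMulMatrix μ)) K] in
/-- **Elements of an over-order are integral**: `x ∈ M = MM ≠ 0 ⟹ x` is integral over `ℤ` (`x` stabilises the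
lattice `L(M) = ⊕ ℤνⱼ`; LEMMA 6.4 of Stevenhagen / the determinant trick, Mathlib's `isIntegral_of_smul_mem_submodule`).
[cite: Marseglia2019, §2 («The fractional `R`-ideals that are rings are called over-orders of `R`» ⊆ `𝒪_K`), p. 4]
[cite: Stevenhagen2008NumberRings, §6 Lemma 6.4, p. 222] -/
theorem isIntegral_of_mem_of_mul_self_eq {M : FractionalIdeal (endOrder (Algebra.leftMulMatrix μ))⁰ K} (hMM : M * M = M)
    (hM0 : M ≠ 0) {x : K} (hx : x ∈ M) : IsIntegral ℤ x := by
  have hbot : ((M : Submodule (endOrder (Algebra.leftMulMatrix μ)) K).restrictScalars ℤ) ≠ ⊥ := by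
    intro h
    apply hM0
    apply coeToSubmodule_inj.1
    rw [coe_zero]
    exact (Submodule.restrictScalars_eq_bot_iff _ _ _).1 h
  refine isIntegral_of_smul_mem_submodule _ hbot (fg_restrictScalars_coe μ M) x fun n hn => ?_
  rw [Submodule.restrictScalars_mem] at hn ⊢
  rw [smul_eq_mul]
  exact mem_coe.2 (hMM.le (mul_mem_mul hx (mem_coe.1 hn)))

omit [IsFractionRing (endOrder (Algebra.leftMulMatrix μ)) K] in
/-- **«One has `A ⊆ A†`»: an over-order is contained in its trace dual, `M ⊆ Mᵗ`** (traces of algebraic integers are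
rational integers). [cite: BuchmannLenstra1994, §2.3 («One has `A ⊂ A†`»), p. 228] -/
theorem le_of_coe_eq_traceDual_self {M TM : FractionalIdeal (endOrder (Algebra.leftMulMatrix μ))⁰ K} (hMM : M * M = M)
    (hM0 : M ≠ 0)
    (hTM : (TM : Submodule (endOrder (Algebra.leftMulMatrix μ)) K) =
      traceDual ℤ ℚ (M : Submodule (endOrder (Algebra.leftMulMatrix μ)) K)) : M ≤ TM := by
  intro x hx
  rw [← mem_coe, hTM, Submodule.mem_traceDual]
  intro a ha
  have hint : IsIntegral ℤ (x * a) := isIntegral_of_mem_of_mul_self_eq μ hMM hM0 (hMM.le (mul_mem_mul hx (mem_coe.1 ha)))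
  obtain ⟨n, hn⟩ := (IsIntegrallyClosed.isIntegral_iff (R := ℤ) (K := ℚ)).1 (Algebra.isIntegral_trace hint)
  exact ⟨n, by rw [Algebra.traceForm_apply, ← hn]⟩

variable [Nonempty ι]

/-- **The multiplicator ring of `Mᵗ` is `M`: `(Mᵗ : Mᵗ) = (M : M) = M`** («to prove that (b) implies (c), it suffices to
prove that `A† : A† = A`»). [cite: BuchmannLenstra1994, §2 Prop. 2.7 (proof, (b)⇒(c)), p. 230] [cite: Marseglia2019, §2 Lemma 2.3, p. 4] -/
theorem traceDual_div_traceDual_eq_of_mul_self_eq {M TM : FractionalIdeal (endOrder (Algebra.leftMulMatrix μ))⁰ K}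
    (hMM : M * M = M) (hM0 : M ≠ 0) (hTM0 : TM ≠ 0)
    (hTM : (TM : Submodule (endOrder (Algebra.leftMulMatrix μ)) K) =
      traceDual ℤ ℚ (M : Submodule (endOrder (Algebra.leftMulMatrix μ)) K)) : TM / TM = M := by
  rw [← div_eq_div_of_coe_eq_traceDual μ hM0 hM0 hTM0 hTM hTM]
  exact EndOrder.div_self_eq_of_mul_self_eq_endOrder hM0 hMM

omit [Nonempty ι] in
/-- **«`a† = A† : a`» relative to an over-order: `Iᵗ = (Mᵗ : I)` for every `M`-ideal `I`** (`MI = I`; `↑TM = Mᵗ`,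
`↑T = Iᵗ`). [cite: BuchmannLenstra1994, §2 Prop. 2.7 (proof: «from the definitions one sees that `a† = A† : a`»), p. 230] -/
theorem traceDual_div_eq_of_mul_eq {M I TM T : FractionalIdeal (endOrder (Algebra.leftMulMatrix μ))⁰ K} (hMI : M * I = I)
    (hI : I ≠ 0)
    (hTM : (TM : Submodule (endOrder (Algebra.leftMulMatrix μ)) K) =
      traceDual ℤ ℚ (M : Submodule (endOrder (Algebra.leftMulMatrix μ)) K))
    (hT : (T : Submodule (endOrder (Algebra.leftMulMatrix μ)) K) =
      traceDual ℤ ℚ (I : Submodule (endOrder (Algebra.leftMulMatrix μ)) K)) : TM / I = T := by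
  apply coeToSubmodule_inj.1
  have hI' : (I : Submodule (endOrder (Algebra.leftMulMatrix μ)) K) =
      (M : Submodule (endOrder (Algebra.leftMulMatrix μ)) K) * (I : Submodule (endOrder (Algebra.leftMulMatrix μ)) K) := by
    rw [← coe_mul, hMI]
  rw [hT]
  ext y
  rw [mem_coe, mem_div_iff_of_ne_zero hI, hI', mem_traceDual_mul_iff, ← hTM]
  simp only [mem_coe]

end OverOrder

end TraceDualIdeal

end CMTypeLattice

/-! ## §4 PROPOSITION 2.7 (a)⇒(b) for an over-order `M`, with no trace duals: if `(M:(M:I)) = I` for all `M`-ideals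
then `(I:I) = M` forces `I·(M:I) = M` -/

namespace EndOrder

section GorensteinAB

variable {K : Type} [Field K] [NumberField K]
variable {ι : Type} [Fintype ι] [DecidableEq ι] [Nonempty ι] {ρ : K →ₐ[ℚ] Matrix ι ι ℚ}
variable [IsFractionRing (endOrder ρ) K]

/-- **PROPOSITION 2.7 / 2.10, (a)⇒(b)** for an over-order `M = MM ≠ 0` of ANY order `𝔯 = endOrder ρ`: if `M` is
Gorenstein in the reflexive sense — `(M:(M:N)) = N` for every `M`-ideal `N` — then every `M`-ideal `I` with
multiplicator ring `(I:I) = M` is invertible in `M`, `I·(M:I) = M`.  Proof: `x(M:I) ⊆ (M:I)` gives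
`x(M:(M:I)) ⊆ (M:(M:I))`, i.e. `x ∈ (I:I) = M`, so `((M:I):(M:I)) = M`; then `J = I(M:I)` has
`(M:J) = ((M:I):(M:I)) = M` (LEMMA 2.1) and `J = (M:(M:J)) = (M:M) = M`.
[cite: BuchmannLenstra1994, §2 Prop. 2.7 ((a)⇒(b)) with Prop. 2.5, p. 230] [cite: Marseglia2019, §2 Prop. 2.10 ((a)⇒(b)), p. 5] -/
theorem mul_div_eq_of_forall_div_div_eq {M : FractionalIdeal (endOrder ρ)⁰ K} (hMM : M * M = M) (hM0 : M ≠ 0)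
    (ha : ∀ N : FractionalIdeal (endOrder ρ)⁰ K, N ≠ 0 → M * N = N → M / (M / N) = N)
    {I : FractionalIdeal (endOrder ρ)⁰ K} (hI : I ≠ 0) (hMI : M * I = I) (hII : I / I = M) : I * (M / I) = M := by
  have h1M : 1 ≤ M := one_le_of_mul_self_eq hMM hM0
  have hMI' : M / I ≠ 0 := div_ne_zero_of_one_le h1M hI
  have hMMI : M * (M / I) = M / I := mul_div_eq_div_of_mul_self_eq_left hMM hM0 hI
  have hI' : M / (M / I) = I := ha I hI hMI
  -- `((M:I):(M:I)) = M`
  have hS : M / I / (M / I) = M := by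
    refine le_antisymm ?_ ((le_div_iff_mul_le hMI').2 hMMI.le)
    have h := div_div_self_le_div_div_div_self hMI' (by rw [hI']; exact hI)
    rwa [hI', hII] at h
  -- `J = I·(M:I)`: `(M:J) = M`, so `J = (M:(M:J)) = M`
  have hJ0 : I * (M / I) ≠ 0 := fractionalIdeal_mul_ne_zero hI hMI'
  have hMJ : M * (I * (M / I)) = I * (M / I) := by rw [← mul_assoc, hMI]
  have h := ha _ hJ0 hMJ
  rw [div_mul_eq_div_div_fractionalIdeal hI hMI', hS, div_self_eq_of_mul_self_eq_endOrder hM0 hMM] at h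
  exact h.symm

/-- **(a)⇒(b) as printed: «for any fractional `A`-ideal `a`, we have `a : a = A` if and only if `a` is invertible»** —
for a reflexive over-order `M` and an `M`-ideal `I`: `(I:I) = M ⟺ ∃ J, IJ = M` (⟸ is LEMMA 2.5, the tree's
`div_self_eq_of_mul_eq_overorder`). [cite: BuchmannLenstra1994, §2 Prop. 2.7 ((a)⇒(b)), p. 230] [cite: Marseglia2019, §2 Prop. 2.10 and Lemma 2.5, p. 5] -/
theorem div_self_eq_iff_exists_mul_eq_of_forall_div_div_eq {M : FractionalIdeal (endOrder ρ)⁰ K} (hMM : M * M = M)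
    (hM0 : M ≠ 0) (ha : ∀ N : FractionalIdeal (endOrder ρ)⁰ K, N ≠ 0 → M * N = N → M / (M / N) = N)
    {I : FractionalIdeal (endOrder ρ)⁰ K} (hI : I ≠ 0) (hMI : M * I = I) :
    I / I = M ↔ ∃ J : FractionalIdeal (endOrder ρ)⁰ K, I * J = M :=
  ⟨fun h => ⟨M / I, mul_div_eq_of_forall_div_div_eq hMM hM0 ha hI hMI h⟩,
    fun ⟨_, hJ⟩ => div_self_eq_of_mul_eq_overorder hMM hM0 hMI hJ⟩

end GorensteinAB

/-! ## §5 PROPOSITION 2.5 (Buchmann–Lenstra) for the order itself: `a` is invertible ⟺ `((A:a):(A:a)) = A`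
⟺ `A:(A:a) = a` and `a:a = A` -/

section PropTwoFive

variable {K : Type} [Field K] [NumberField K]
variable {ι : Type} [Fintype ι] [DecidableEq ι] [Nonempty ι] {ρ : K →ₐ[ℚ] Matrix ι ι ℚ}
variable [IsFractionRing (endOrder ρ) K]

/-- **PROPOSITION 2.5, first equivalence: `a` is invertible iff the over-order `(A:a):(A:a)` equals `A`.**  (⟸: if
`a` is not invertible then `J = (A:a)a ⊊ A` is a proper nonzero ideal, and `A:J = (A:a):(A:a)` strictly contains
`A` — the tree's `NumberRing.not_inv_coeIdeal_le_one`, Prop. 2.4 (b).)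
[cite: BuchmannLenstra1994, §2 Prop. 2.5 and Prop. 2.4 (b), pp. 229–230] -/
theorem isUnit_iff_one_div_div_one_div_eq_one {I : FractionalIdeal (endOrder ρ)⁰ K} (hI : I ≠ 0) :
    IsUnit I ↔ 1 / I / (1 / I) = 1 := by
  haveI := CMTypeLattice.isNoetherianRing_endOrder ρ
  haveI := CMTypeLattice.dimensionLEOne_endOrder ρ
  have hI' : 1 / I ≠ 0 := div_ne_zero_of_one_le le_rfl hI
  constructor
  · intro hu
    have h1 : 1 / I * I = 1 := by rw [mul_comm, ← inv_eq, (mul_inv_cancel_iff_isUnit K).2 hu]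
    exact fractionalIdeal_div_self_of_isUnit (IsUnit.of_mul_eq_one _ h1)
  · intro h
    by_contra hu
    -- `J = a(A:a)`, a proper nonzero ideal with `(A:J) = ((A:a):(A:a)) = A`
    have hJ1 : I * (1 / I) ≤ 1 := mul_one_div_le_one
    have hJne : I * (1 / I) ≠ 1 := fun hJ => hu (IsUnit.of_mul_eq_one _ hJ)
    obtain ⟨J₀, hJ₀⟩ := le_one_iff_exists_coeIdeal.1 hJ1
    have hJ₀0 : J₀ ≠ ⊥ := by
      rintro rfl
      rw [coeIdeal_bot] at hJ₀
      exact fractionalIdeal_mul_ne_zero hI hI' hJ₀.symm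
    have hJ₀1 : J₀ ≠ ⊤ := by
      rintro rfl
      rw [coeIdeal_top] at hJ₀
      exact hJne hJ₀.symm
    apply NumberRing.not_inv_coeIdeal_le_one (L := K) hJ₀0 hJ₀1
    rw [hJ₀, inv_eq, div_mul_eq_div_div_fractionalIdeal hI hI', h]

/-- **PROPOSITION 2.5, second equivalence: `a` is invertible iff both `A:(A:a) = a` and `a:a = A`** (for the order
`A = 𝔯` itself). [cite: BuchmannLenstra1994, §2 Prop. 2.5, p. 230] -/
theorem isUnit_iff_one_div_one_div_eq_and_div_self_eq_one {I : FractionalIdeal (endOrder ρ)⁰ K} (hI : I ≠ 0) :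
    IsUnit I ↔ 1 / (1 / I) = I ∧ I / I = 1 := by
  have hI' : 1 / I ≠ 0 := div_ne_zero_of_one_le le_rfl hI
  constructor
  · intro hu
    refine ⟨?_, fractionalIdeal_div_self_of_isUnit hu⟩
    rw [← inv_eq, ← inv_eq]
    exact (right_inverse_eq K _ _ (by rw [mul_comm, (mul_inv_cancel_iff_isUnit K).2 hu])).symm
  · rintro ⟨h1, h2⟩
    rw [isUnit_iff_one_div_div_one_div_eq_one hI]
    refine le_antisymm ?_ (one_le_div_self hI')
    have h := div_div_self_le_div_div_div_self (S := 1) hI' (by rw [h1]; exact hI)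
    rwa [h1, h2] at h

end PropTwoFive

end EndOrder

/-! ## §6 PROPOSITION 2.7 (b)⇒(c)⇒(a) and the equivalence (a) ⟺ (b) ⟺ (c) for every over-order `M` of `𝔬`;
the order itself -/

namespace CMTypeLattice

section Gorenstein

variable {K : Type} [Field K] [NumberField K]
variable {ι : Type} [Fintype ι] [DecidableEq ι] [Nonempty ι] (μ : Basis ι ℚ K)
variable [IsFractionRing (endOrder (Algebra.leftMulMatrix μ)) K]

/-- **PROPOSITION 2.7, (b)⇒(c): if every `M`-ideal with multiplicator ring `M` is invertible in `M`, then `Mᵗ` is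
invertible in `M`** (`Mᵗ` is an `M`-ideal with `(Mᵗ : Mᵗ) = M`). [cite: BuchmannLenstra1994, §2 Prop. 2.7 ((b)⇒(c)), p. 230]
[cite: Marseglia2019, §2 Prop. 2.10 ((b)⇒(c)), p. 5] -/
theorem traceDual_mul_div_eq_of_forall_mul_div_eq {M TM : FractionalIdeal (endOrder (Algebra.leftMulMatrix μ))⁰ K}
    (hMM : M * M = M) (hM0 : M ≠ 0)
    (hb : ∀ I : FractionalIdeal (endOrder (Algebra.leftMulMatrix μ))⁰ K, I ≠ 0 → M * I = I → I / I = M → I * (M / I) = M)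
    (hTM0 : TM ≠ 0)
    (hTM : (TM : Submodule (endOrder (Algebra.leftMulMatrix μ)) K) =
      traceDual ℤ ℚ (M : Submodule (endOrder (Algebra.leftMulMatrix μ)) K)) : TM * (M / TM) = M := by
  haveI := isNoetherianRing_endOrder (Algebra.leftMulMatrix μ)
  exact hb TM hTM0 (mul_eq_of_coe_eq_traceDual μ hMM (EndOrder.one_mem_of_mul_self_eq hM0 hMM) hTM)
    (traceDual_div_traceDual_eq_of_mul_self_eq μ hMM hM0 hTM0 hTM)

/-- **PROPOSITION 2.7, (c)⇒(a): if `Mᵗ` is invertible in `M` (`Mᵗ·B = M`) then `M:(M:a) = a` for every `M`-ideal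
`a`** — Buchmann–Lenstra's computation: with `b = M:Mᵗ` the inverse, `a = a†† = A†:(A†:a)`,
`A†:a = (A:b):a = A:(ab) = (A:a):b = (A:a)A†` and `A†:(A†:a) = A†:((A:a)A†) = (A†:A†):(A:a) = A:(A:a)`.
[cite: BuchmannLenstra1994, §2 Prop. 2.7 ((c)⇒(a)), pp. 230–231] [cite: Marseglia2019, §2 Prop. 2.10 ((c)⇒(a)), p. 5] -/
theorem div_div_eq_of_traceDual_mul_eq {M TM B : FractionalIdeal (endOrder (Algebra.leftMulMatrix μ))⁰ K}
    (hMM : M * M = M) (hM0 : M ≠ 0)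
    (hTM : (TM : Submodule (endOrder (Algebra.leftMulMatrix μ)) K) =
      traceDual ℤ ℚ (M : Submodule (endOrder (Algebra.leftMulMatrix μ)) K))
    (hc : TM * B = M) {I : FractionalIdeal (endOrder (Algebra.leftMulMatrix μ))⁰ K} (hI : I ≠ 0) (hMI : M * I = I) :
    M / (M / I) = I := by
  haveI := isNoetherianRing_endOrder (Algebra.leftMulMatrix μ)
  have h1M : (1 : K) ∈ M := EndOrder.one_mem_of_mul_self_eq hM0 hMM
  have hTM0 : TM ≠ 0 := fun h => hM0 (by rw [← hc, h, zero_mul])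
  have hB0 : B ≠ 0 := fun h => hM0 (by rw [← hc, h, mul_zero])
  have hMI0 : M / I ≠ 0 := EndOrder.div_ne_zero_of_one_le (FractionalIdeal.one_le.2 h1M) hI
  have hMTM : M * TM = TM := mul_eq_of_coe_eq_traceDual μ hMM h1M hTM
  obtain ⟨T, hT0, hT⟩ := exists_coe_eq_traceDual μ hI
  have hMT : M * T = T := mul_eq_of_coe_eq_traceDual μ hMI h1M hT
  -- `a† = A† : a` and `a = a†† = A† : a†`
  have h1 : TM / I = T := traceDual_div_eq_of_mul_eq μ hMI hI hTM hT
  have h2 : TM / T = I := traceDual_div_eq_of_mul_eq μ hMT hT0 hTM (by rw [hT, traceDual_traceDual_coe μ hI])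
  -- `A† = A : b`, `A† : a = (A : a)·A†`
  have hTMeq : TM = M / B := by
    rw [EndOrder.div_eq_mul_of_mul_eq hMM hM0 hMM (by rw [mul_comm]; exact hc), hMTM]
  have h3 : TM / I = M / I * TM := by
    conv_lhs => rw [hTMeq, ← EndOrder.div_mul_eq_div_div_fractionalIdeal hB0 hI, mul_comm B I,
      EndOrder.div_mul_eq_div_div_fractionalIdeal hI hB0]
    exact EndOrder.div_eq_mul_of_mul_eq hMM hM0 (EndOrder.mul_div_eq_div_of_mul_self_eq_left hMM hM0 hI)
      (by rw [mul_comm]; exact hc)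
  -- `A† : (A† : a) = (A† : A†) : (A : a) = A : (A : a)`
  have h4 : TM / (TM / I) = M / (M / I) := by
    rw [h3, mul_comm, EndOrder.div_mul_eq_div_div_fractionalIdeal hTM0 hMI0,
      traceDual_div_traceDual_eq_of_mul_self_eq μ hMM hM0 hTM0 hTM]
  rw [← h4, h1, h2]

/-- **PROPOSITION 2.7: (a) `M` is Gorenstein (`M:(M:a) = a` for all `M`-ideals) ⟺ (c) `Mᵗ` is invertible in `M`**
(`Mᵗ·(M:Mᵗ) = M`), for every over-order `M` of the order `𝔬`, in any degree.
[cite: BuchmannLenstra1994, §2 Prop. 2.7 ((a)⟺(c)), p. 230] [cite: Marseglia2019, §2 Prop. 2.10 ((a)⟺(c)), p. 5] -/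
theorem forall_div_div_eq_iff_traceDual_mul_div_eq {M TM : FractionalIdeal (endOrder (Algebra.leftMulMatrix μ))⁰ K}
    (hMM : M * M = M) (hM0 : M ≠ 0) (hTM0 : TM ≠ 0)
    (hTM : (TM : Submodule (endOrder (Algebra.leftMulMatrix μ)) K) =
      traceDual ℤ ℚ (M : Submodule (endOrder (Algebra.leftMulMatrix μ)) K)) :
    (∀ I : FractionalIdeal (endOrder (Algebra.leftMulMatrix μ))⁰ K, I ≠ 0 → M * I = I → M / (M / I) = I) ↔
      TM * (M / TM) = M :=
  ⟨fun ha => traceDual_mul_div_eq_of_forall_mul_div_eq μ hMM hM0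
      (fun _ hI hMI hII => EndOrder.mul_div_eq_of_forall_div_div_eq hMM hM0 ha hI hMI hII) hTM0 hTM,
    fun hc _ hI hMI => div_div_eq_of_traceDual_mul_eq μ hMM hM0 hTM hc hI hMI⟩

/-- **PROPOSITION 2.7: (a) `M` is Gorenstein ⟺ (b) for every `M`-ideal `a`, `a:a = M` iff `a` is invertible in `M`.**
[cite: BuchmannLenstra1994, §2 Prop. 2.7 ((a)⟺(b)), p. 230] [cite: Marseglia2019, §2 Prop. 2.10 ((a)⟺(b)), p. 5] -/
theorem forall_div_div_eq_iff_forall_div_self_eq_iff_mul_div_eq {M : FractionalIdeal (endOrder (Algebra.leftMulMatrix μ))⁰ K}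
    (hMM : M * M = M) (hM0 : M ≠ 0) :
    (∀ I : FractionalIdeal (endOrder (Algebra.leftMulMatrix μ))⁰ K, I ≠ 0 → M * I = I → M / (M / I) = I) ↔
      ∀ I : FractionalIdeal (endOrder (Algebra.leftMulMatrix μ))⁰ K, I ≠ 0 → M * I = I → (I / I = M ↔ I * (M / I) = M) := by
  constructor
  · intro ha I hI hMI
    exact ⟨EndOrder.mul_div_eq_of_forall_div_div_eq hMM hM0 ha hI hMI,
      fun h => EndOrder.div_self_eq_of_mul_eq_overorder hMM hM0 hMI h⟩
  · intro hb
    obtain ⟨TM, hTM0, hTM⟩ := exists_coe_eq_traceDual μ hM0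
    exact (forall_div_div_eq_iff_traceDual_mul_div_eq μ hMM hM0 hTM0 hTM).2
      (traceDual_mul_div_eq_of_forall_mul_div_eq μ hMM hM0 (fun I hI hMI hII => (hb I hI hMI).1 hII) hTM0 hTM)

/-- **The order `𝔬` itself (`M = 𝔬 = 1`): `𝔬` is Gorenstein — `(𝔬:(𝔬:I)) = I` for all `I ≠ 0` — iff its trace dual
`𝔬ᵗ` is an invertible fractional ideal.** [cite: BuchmannLenstra1994, §2 Prop. 2.7 ((a)⟺(c)), p. 230]
[cite: Marseglia2019, §2 Prop. 2.10 ((a)⟺(c)), p. 5] -/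
theorem forall_one_div_one_div_eq_iff_isUnit_traceDual {T : FractionalIdeal (endOrder (Algebra.leftMulMatrix μ))⁰ K}
    (hT : (T : Submodule (endOrder (Algebra.leftMulMatrix μ)) K) =
      traceDual ℤ ℚ ((1 : FractionalIdeal (endOrder (Algebra.leftMulMatrix μ))⁰ K) :
        Submodule (endOrder (Algebra.leftMulMatrix μ)) K)) :
    (∀ I : FractionalIdeal (endOrder (Algebra.leftMulMatrix μ))⁰ K, I ≠ 0 → 1 / (1 / I) = I) ↔ IsUnit T := by
  have hT0 : T ≠ 0 := by
    obtain ⟨T', hT'0, hT'⟩ := exists_coe_eq_traceDual μ (one_ne_zero' (FractionalIdeal (endOrder (Algebra.leftMulMatrix μ))⁰ K))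
    rwa [← coeToSubmodule_inj.1 (hT'.trans hT.symm)]
  have h := forall_div_div_eq_iff_traceDual_mul_div_eq μ (one_mul 1) one_ne_zero hT0 hT
  simp only [one_mul, forall_const] at h
  rw [h, ← inv_eq, mul_inv_cancel_iff_isUnit K]

/-- **The order `𝔬` itself: Gorenstein ⟺ «`(I:I) = R` if and only if `I` is invertible» for every `I ≠ 0`.**
[cite: BuchmannLenstra1994, §2 Prop. 2.7 ((a)⟺(b)), p. 230] [cite: Marseglia2019, §2 Prop. 2.10 ((a)⟺(b)), p. 5] -/
theorem forall_one_div_one_div_eq_iff_forall_isUnit_iff_div_self_eq_one :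
    (∀ I : FractionalIdeal (endOrder (Algebra.leftMulMatrix μ))⁰ K, I ≠ 0 → 1 / (1 / I) = I) ↔
      ∀ I : FractionalIdeal (endOrder (Algebra.leftMulMatrix μ))⁰ K, I ≠ 0 → (IsUnit I ↔ I / I = 1) := by
  have h := forall_div_div_eq_iff_forall_div_self_eq_iff_mul_div_eq μ (M := 1) (one_mul 1) one_ne_zero
  simp only [one_mul, forall_const] at h
  rw [h]
  refine forall₂_congr fun I _ => ?_
  rw [← inv_eq, mul_inv_cancel_iff_isUnit K]
  exact Iff.comm

end Gorenstein

/-! ## §7 EXAMPLE 2.8 / COROLLARY 2.11: monogenic orders are Gorenstein (`ℤ[π]ᵗ = f′(π)⁻¹ℤ[π]` is principal);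
every quadratic order; `ℤ[√-3]` -/

section Monogenic

variable {K : Type} [Field K] [NumberField K]
variable {ι : Type} [Fintype ι] [DecidableEq ι] [Nonempty ι] (μ : Basis ι ℚ K)
variable [IsFractionRing (endOrder (Algebra.leftMulMatrix μ)) K]

open Polynomial in
omit [Nonempty ι] in
/-- **EXAMPLE 2.8: «if we write `α = (X mod f)` then `A† = f′(α)⁻¹A`»** — for an over-order `M = ℤ[π]` (`ℚ(π) = K`,
`π` integral, `f` the minimal polynomial of `π`): `Mᵗ = f′(π)⁻¹·M` (Euler's lemma; the tree's `traceDual_adjoin_eq`).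
[cite: BuchmannLenstra1994, §2 Example 2.8, p. 231] [cite: Marseglia2019, §2 Cor. 2.11 (proof: «`R^t = (1/f′(α))R`»), p. 5] -/
theorem eq_spanSingleton_inv_mul_of_monogenic {M TM : FractionalIdeal (endOrder (Algebra.leftMulMatrix μ))⁰ K} {π : K}
    (hπ : Algebra.adjoin ℚ {π} = ⊤) (hint : IsIntegral ℤ π)
    (hMπ : (M : Submodule (endOrder (Algebra.leftMulMatrix μ)) K).restrictScalars ℤ =
      Subalgebra.toSubmodule (Algebra.adjoin ℤ {π}))
    (hTM : (TM : Submodule (endOrder (Algebra.leftMulMatrix μ)) K) =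
      traceDual ℤ ℚ (M : Submodule (endOrder (Algebra.leftMulMatrix μ)) K)) :
    TM = spanSingleton (endOrder (Algebra.leftMulMatrix μ))⁰ (aeval π (derivative (minpoly ℚ π)))⁻¹ * M := by
  apply eq_of_restrictScalars_coe_eq_endOrder μ
  rw [(coe_eq_traceDual_iff μ).1 hTM, restrictScalars_coe_spanSingleton_mul_endOrder, hMπ, traceDual_adjoin_eq hπ hint]

open Polynomial in
omit [Nonempty ι] in
/-- **Monogenic over-orders are Gorenstein, form (c): `Mᵗ · (f′(π)M) = M`** — `Mᵗ = f′(π)⁻¹M` is invertible in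
`M = ℤ[π]`. [cite: BuchmannLenstra1994, §2 Example 2.8 («This shows that `A†` is invertible»), p. 231]
[cite: Marseglia2019, §2 Cor. 2.11, p. 5] -/
theorem traceDual_mul_eq_of_monogenic {M TM : FractionalIdeal (endOrder (Algebra.leftMulMatrix μ))⁰ K} {π : K}
    (hMM : M * M = M) (hπ : Algebra.adjoin ℚ {π} = ⊤) (hint : IsIntegral ℤ π)
    (hMπ : (M : Submodule (endOrder (Algebra.leftMulMatrix μ)) K).restrictScalars ℤ =
      Subalgebra.toSubmodule (Algebra.adjoin ℤ {π}))
    (hTM : (TM : Submodule (endOrder (Algebra.leftMulMatrix μ)) K) =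
      traceDual ℤ ℚ (M : Submodule (endOrder (Algebra.leftMulMatrix μ)) K)) :
    TM * (spanSingleton (endOrder (Algebra.leftMulMatrix μ))⁰ (aeval π (derivative (minpoly ℚ π))) * M) = M := by
  have hne : aeval π (derivative (minpoly ℚ π)) ≠ 0 :=
    (Algebra.IsSeparable.isSeparable ℚ π).aeval_derivative_ne_zero (minpoly.aeval ℚ π)
  rw [eq_spanSingleton_inv_mul_of_monogenic μ hπ hint hMπ hTM, mul_mul_mul_comm, spanSingleton_mul_spanSingleton,
    inv_mul_cancel₀ hne, spanSingleton_one, one_mul, hMM]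

open Polynomial in
/-- **EXAMPLE 2.8 / COROLLARY 2.11: «Monogenic orders are Gorenstein»** — for a monogenic over-order `M = ℤ[π]` of `𝔬`,
`(M:(M:I)) = I` for every `M`-ideal `I ≠ 0`. [cite: BuchmannLenstra1994, §2 Example 2.8 («so 2.7 implies that `A` is a
Gorenstein ring»), p. 231] [cite: Marseglia2019, §2 Cor. 2.11, p. 5] -/
theorem div_div_eq_of_monogenic {M : FractionalIdeal (endOrder (Algebra.leftMulMatrix μ))⁰ K} {π : K}
    (hMM : M * M = M) (hM0 : M ≠ 0) (hπ : Algebra.adjoin ℚ {π} = ⊤) (hint : IsIntegral ℤ π)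
    (hMπ : (M : Submodule (endOrder (Algebra.leftMulMatrix μ)) K).restrictScalars ℤ =
      Subalgebra.toSubmodule (Algebra.adjoin ℤ {π}))
    {I : FractionalIdeal (endOrder (Algebra.leftMulMatrix μ))⁰ K} (hI : I ≠ 0) (hMI : M * I = I) : M / (M / I) = I := by
  obtain ⟨TM, -, hTM⟩ := exists_coe_eq_traceDual μ hM0
  exact div_div_eq_of_traceDual_mul_eq μ hMM hM0 hTM (traceDual_mul_eq_of_monogenic μ hMM hπ hint hMπ hTM) hI hMI

open Polynomial in
/-- **The monogenic ORDER `𝔬 = (𝔪 : 𝔪) = ℤ[π]` is Gorenstein: `(𝔬:(𝔬:I)) = I` for every nonzero fractional ideal, and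
`I` is invertible iff `(I:I) = 𝔬`** (hypothesis in the form of `CMLatticeTraceDual.mul_smul_traceDual_eq_div_self_of_monogenic`).
[cite: BuchmannLenstra1994, §2 Example 2.8 with Prop. 2.7, pp. 230–231] [cite: Marseglia2019, §2 Cor. 2.11 with Prop. 2.10, p. 5] -/
theorem one_div_one_div_eq_and_isUnit_iff_of_monogenic {π : K} (hπ : Algebra.adjoin ℚ {π} = ⊤) (hint : IsIntegral ℤ π)
    (h𝔬 : Submodule.span ℤ (Set.range μ) / Submodule.span ℤ (Set.range μ) = Subalgebra.toSubmodule (Algebra.adjoin ℤ {π}))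
    {I : FractionalIdeal (endOrder (Algebra.leftMulMatrix μ))⁰ K} (hI : I ≠ 0) :
    1 / (1 / I) = I ∧ (IsUnit I ↔ I / I = 1) := by
  have hMπ : ((1 : FractionalIdeal (endOrder (Algebra.leftMulMatrix μ))⁰ K) :
      Submodule (endOrder (Algebra.leftMulMatrix μ)) K).restrictScalars ℤ = Subalgebra.toSubmodule (Algebra.adjoin ℤ {π}) := by
    rw [restrictScalars_coe_one_eq_div_self, h𝔬]
  have ha : ∀ I : FractionalIdeal (endOrder (Algebra.leftMulMatrix μ))⁰ K, I ≠ 0 → 1 / (1 / I) = I := fun I hI => by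
    exact div_div_eq_of_monogenic μ (M := 1) (one_mul 1)
      (one_ne_zero : (1 : FractionalIdeal (endOrder (Algebra.leftMulMatrix μ))⁰ K) ≠ 0) hπ hint hMπ hI (one_mul I)
  exact ⟨ha I hI, (forall_one_div_one_div_eq_iff_forall_isUnit_iff_div_self_eq_one μ).1 ha I hI⟩

end Monogenic

section Quadratic

variable {K : Type} [Field K] [NumberField K]
variable (μ : Basis (Fin 2) ℚ K) [IsFractionRing (endOrder (Algebra.leftMulMatrix μ)) K]

open Polynomial in
/-- **Every order of a QUADRATIC field is Gorenstein in Buchmann–Lenstra's sense (c): its trace dual `𝔬ᵗ` is a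
PRINCIPAL, hence invertible, fractional ideal `𝔬ᵗ = γ⁻¹𝔬`** (the order `(𝔪 : 𝔪) = ℤ[aτ]` is monogenic —
`CMLatticeTraceDual.exists_div_self_eq_adjoin` — and `γ = g′(aτ)`); by §6 this re-derives `(𝔬:(𝔬:I)) = I`
(`CMOrderQuadraticOverorders.one_div_one_div_eq`, obtained there through conductors) by the printed route.
[cite: BuchmannLenstra1994, §2 Example 2.8 and Prop. 2.7, pp. 230–231] [cite: Marseglia2019, §2 Cor. 2.11 and «every order in a
quadratic number field is a Bass order», p. 5] -/
theorem exists_traceDual_one_eq_spanSingleton_inv {T : FractionalIdeal (endOrder (Algebra.leftMulMatrix μ))⁰ K}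
    (hT : (T : Submodule (endOrder (Algebra.leftMulMatrix μ)) K) =
      traceDual ℤ ℚ ((1 : FractionalIdeal (endOrder (Algebra.leftMulMatrix μ))⁰ K) :
        Submodule (endOrder (Algebra.leftMulMatrix μ)) K)) :
    ∃ γ : K, γ ≠ 0 ∧ T = spanSingleton (endOrder (Algebra.leftMulMatrix μ))⁰ γ⁻¹ ∧ IsUnit T := by
  have h2 : finrank ℚ K = 2 := by rw [finrank_eq_card_basis μ, Fintype.card_fin]
  obtain ⟨π, hint, hπ, h𝔬⟩ := exists_div_self_eq_adjoin h2 μ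
  have hMπ : ((1 : FractionalIdeal (endOrder (Algebra.leftMulMatrix μ))⁰ K) :
      Submodule (endOrder (Algebra.leftMulMatrix μ)) K).restrictScalars ℤ = Subalgebra.toSubmodule (Algebra.adjoin ℤ {π}) := by
    rw [restrictScalars_coe_one_eq_div_self, h𝔬]
  have hne : aeval π (derivative (minpoly ℚ π)) ≠ 0 :=
    (Algebra.IsSeparable.isSeparable ℚ π).aeval_derivative_ne_zero (minpoly.aeval ℚ π)
  refine ⟨aeval π (derivative (minpoly ℚ π)), hne, ?_, ?_⟩
  · rw [eq_spanSingleton_inv_mul_of_monogenic μ hπ hint hMπ hT, mul_one]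
  · exact IsUnit.of_mul_eq_one _ (traceDual_mul_eq_of_monogenic μ (M := 1) (one_mul 1) hπ hint hMπ hT)

end Quadratic

end CMTypeLattice

end Literature.NumberTheory.ComplexMultiplication
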